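import Literature.NumberTheory.Sieve.KloostermanQuintilinearMixedDerivCalculus
import Mathlib.Analysis.Normed.Operator.Mul
import HarnessLib

/-!
# Fréchet-derivative tools on `ℝ⁵` for non-separable five-variable weights

Topic `Literature/NumberTheory/Sieve`, companion of `KloostermanQuintilinearMixedDerivCalculus.lean`.
In the Poisson-summation step of Drappeau 2017, §4.3.3 (towards the named fact
`Literature.NumberTheory.Sieve.AssingBlomerLi2020_theorem23`) the weight fed to Proposition 4.13 is
`W(c,h,n,r,s) = φ(h)·U(n)V(r)W(s)·g(c, θv·s·c, n, r, s)`: a product of one-variable cut-offs with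
the given weight `g` composed with the polynomial map `Φ_v(y) = (y₀, v y₀ y₄, y₂, y₃, y₄)`
(`PhiV v`).  Its derivative bounds are obtained from Mathlib's Leibniz and Faà di Bruno estimates
(`norm_iteratedFDeriv_mul_le`, `norm_iteratedFDeriv_comp_le`); this file supplies the pieces:

* `norm_iteratedFDeriv_clm_one`, `norm_iteratedFDeriv_clm_add_two` — derivatives of continuous
  linear maps (`‖D¹L‖ = ‖L‖`, `D^{i+2} L = 0`);
* `norm_iteratedFDeriv_comp_coord_le` — `‖Dⁱ (y ↦ f(y_l))(y)‖ ≤ |f⁽ⁱ⁾(y_l)|` for `f : ℝ → ℂ`;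
* `norm_iteratedFDeriv_mul_le_of_le` — uniform Leibniz: bounds `A`, `B` for all orders `≤ k` give
  `2ᵏAB` for the product;
* `PhiV v` and `norm_iteratedFDeriv_PhiV_le` — `‖Dⁱ Φ_v(y)‖ ≤ (2 + v(|y₀| + |y₄| + 2))ⁱ`, `i ≥ 1`;
* `norm_iteratedFDeriv_comp_PhiV_le` — Faà di Bruno through `Φ_v`.

Everything PROVED ([folklore]); one definition (`PhiV`), no named fact.

## References

* S. Drappeau, Proc. LMS (3) 114 (2017), §4.3.3. [cite: Drappeau2017, §4.3.3]
-/

noncomputable section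

open scoped ContDiff BigOperators
open Function Finset

namespace Literature.NumberTheory.Sieve

namespace KloostermanQuintilinear

/-! ### Continuous linear maps -/

section CLM

variable {E F : Type*} [NormedAddCommGroup E] [NormedSpace ℝ E] [NormedAddCommGroup F]
  [NormedSpace ℝ F]

/-- `‖D¹ L (y)‖ = ‖L‖` for a continuous linear map. [folklore] -/
theorem norm_iteratedFDeriv_clm_one (L : E →L[ℝ] F) (y : E) :
    ‖iteratedFDeriv ℝ 1 (⇑L) y‖ = ‖L‖ := by
  rw [norm_iteratedFDeriv_one, L.fderiv]

/-- `D^{i+2} L = 0` for a continuous linear map. [folklore] -/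
theorem norm_iteratedFDeriv_clm_add_two (L : E →L[ℝ] F) (i : ℕ) (y : E) :
    ‖iteratedFDeriv ℝ (i + 2) (⇑L) y‖ = 0 := by
  rw [← norm_iteratedFDeriv_fderiv]
  have : fderiv ℝ (⇑L) = fun _ => L := by funext x; exact L.fderiv
  rw [this, iteratedFDeriv_succ_const]
  simp

/-- All orders at once: `‖Dⁱ L (y)‖ ≤ ‖L y‖·1_{i=0} + ‖L‖·1_{i=1}`. [folklore] -/
theorem norm_iteratedFDeriv_clm_le (L : E →L[ℝ] F) (i : ℕ) (y : E) :
    ‖iteratedFDeriv ℝ i (⇑L) y‖ ≤ (if i = 0 then ‖L y‖ else 0) + (if i = 1 then ‖L‖ else 0) := by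
  rcases i with _ | _ | i
  · simp [norm_iteratedFDeriv_zero]
  · simp
  · rw [norm_iteratedFDeriv_clm_add_two]
    simp

end CLM

/-! ### One-variable factors -/

/-- The coordinate projection `y ↦ y_l` has operator norm `≤ 1` (sup norm). [folklore] -/
theorem norm_proj_le_one (l : Fin 5) : ‖(ContinuousLinearMap.proj l : R5 →L[ℝ] ℝ)‖ ≤ 1 := by
  refine ContinuousLinearMap.opNorm_le_bound _ zero_le_one fun y => ?_
  rw [one_mul]
  exact norm_le_pi_norm y l

/-- **`‖Dⁱ (y ↦ f(y_l))(y)‖ ≤ |f⁽ⁱ⁾(y_l)|`** for a smooth `f : ℝ → ℂ`. [folklore] -/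
theorem norm_iteratedFDeriv_comp_coord_le {f : ℝ → ℂ} (hf : ContDiff ℝ ∞ f) (l : Fin 5) (i : ℕ)
    (y : R5) : ‖iteratedFDeriv ℝ i (fun y : R5 => f (y l)) y‖ ≤ ‖iteratedDeriv i f (y l)‖ := by
  have h := ContinuousLinearMap.iteratedFDeriv_comp_right
    (ContinuousLinearMap.proj l : R5 →L[ℝ] ℝ) hf y (i := i) (by exact_mod_cast le_top)
  rw [show (fun y : R5 => f (y l)) = f ∘ (ContinuousLinearMap.proj l : R5 →L[ℝ] ℝ) from rfl, h]
  refine (ContinuousMultilinearMap.norm_compContinuousLinearMap_le _ _).trans ?_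
  rw [norm_iteratedFDeriv_eq_norm_iteratedDeriv]
  have hprod : ∏ _i : Fin i, ‖(ContinuousLinearMap.proj l : R5 →L[ℝ] ℝ)‖ ≤ 1 :=
    Finset.prod_le_one (fun _ _ => norm_nonneg _) fun _ _ => norm_proj_le_one l
  calc ‖iteratedDeriv i f ((ContinuousLinearMap.proj l : R5 →L[ℝ] ℝ) y)‖ *
        ∏ _i : Fin i, ‖(ContinuousLinearMap.proj l : R5 →L[ℝ] ℝ)‖
      ≤ ‖iteratedDeriv i f ((ContinuousLinearMap.proj l : R5 →L[ℝ] ℝ) y)‖ * 1 :=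
        mul_le_mul_of_nonneg_left hprod (norm_nonneg _)
    _ = ‖iteratedDeriv i f (y l)‖ := by rw [mul_one]; rfl

/-! ### Uniform Leibniz -/

/-- **Uniform Leibniz bound**: if `‖Dⁱ F(y)‖ ≤ A` and `‖Dⁱ G(y)‖ ≤ B` for all `i ≤ k`, then
`‖Dⁱ(FG)(y)‖ ≤ 2ᵏ A B` for all `i ≤ k`. [folklore] -/
theorem norm_iteratedFDeriv_mul_le_of_le {F G : R5 → ℂ} (hF : ContDiff ℝ ∞ F) (hG : ContDiff ℝ ∞ G)
    {k : ℕ} {y : R5} {A B : ℝ} (hA : 0 ≤ A) (hB : 0 ≤ B)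
    (hFb : ∀ i, i ≤ k → ‖iteratedFDeriv ℝ i F y‖ ≤ A)
    (hGb : ∀ i, i ≤ k → ‖iteratedFDeriv ℝ i G y‖ ≤ B) :
    ∀ i, i ≤ k → ‖iteratedFDeriv ℝ i (fun y => F y * G y) y‖ ≤ 2 ^ k * A * B := by
  intro i hi
  refine (norm_iteratedFDeriv_mul_le hF hG y (n := i) (by exact_mod_cast le_top)).trans ?_
  calc ∑ l ∈ Finset.range (i + 1),
        (i.choose l : ℝ) * ‖iteratedFDeriv ℝ l F y‖ * ‖iteratedFDeriv ℝ (i - l) G y‖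
      ≤ ∑ l ∈ Finset.range (i + 1), (i.choose l : ℝ) * A * B := by
        refine Finset.sum_le_sum fun l hl => ?_
        have hl' : l ≤ i := Nat.lt_succ_iff.mp (Finset.mem_range.mp hl)
        have h1 := hFb l (hl'.trans hi)
        have h2 := hGb (i - l) ((Nat.sub_le i l).trans hi)
        have h3 : (0 : ℝ) ≤ i.choose l := by positivity
        calc (i.choose l : ℝ) * ‖iteratedFDeriv ℝ l F y‖ * ‖iteratedFDeriv ℝ (i - l) G y‖
            ≤ (i.choose l : ℝ) * A * ‖iteratedFDeriv ℝ (i - l) G y‖ := by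
              gcongr
          _ ≤ (i.choose l : ℝ) * A * B := by
              gcongr
    _ = (∑ l ∈ Finset.range (i + 1), (i.choose l : ℝ)) * A * B := by
        rw [Finset.sum_mul, Finset.sum_mul]
    _ = 2 ^ i * A * B := by
        congr 1
        congr 1
        have := Nat.sum_range_choose i
        exact_mod_cast this
    _ ≤ 2 ^ k * A * B := by
        gcongr
        norm_num

/-! ### The substitution map `Φ_v` -/

/-- `Φ_v(y) = (y₀, v y₀ y₄, y₂, y₃, y₄)` — the `d`-slot `θv·s·c` of Drappeau's §4.3.3 in normalised
coordinates. [cite: Drappeau2017, §4.3.3] -/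
def PhiV (v : ℝ) (y : R5) : R5 := y + (v * y 0 * y 4 - y 1) • e5 1

/-- The `d`-coordinate of `Φ_v`. [folklore] -/
@[simp] theorem PhiV_apply_one (v : ℝ) (y : R5) : PhiV v y 1 = v * y 0 * y 4 := by
  simp [PhiV]

/-- The other coordinates of `Φ_v`. [folklore] -/
theorem PhiV_apply_of_ne (v : ℝ) (y : R5) {l : Fin 5} (hl : l ≠ 1) : PhiV v y l = y l := by
  simp [PhiV, e5_apply, hl]

/-- Coordinate `0` of `Φ_v`. [folklore] -/
@[simp] theorem PhiV_apply_zero (v : ℝ) (y : R5) : PhiV v y 0 = y 0 := PhiV_apply_of_ne v y (by decide)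
/-- Coordinate `2` of `Φ_v`. [folklore] -/
@[simp] theorem PhiV_apply_two (v : ℝ) (y : R5) : PhiV v y 2 = y 2 := PhiV_apply_of_ne v y (by decide)
/-- Coordinate `3` of `Φ_v`. [folklore] -/
@[simp] theorem PhiV_apply_three (v : ℝ) (y : R5) : PhiV v y 3 = y 3 := PhiV_apply_of_ne v y (by decide)
/-- Coordinate `4` of `Φ_v`. [folklore] -/
@[simp] theorem PhiV_apply_four (v : ℝ) (y : R5) : PhiV v y 4 = y 4 := PhiV_apply_of_ne v y (by decide)

/-- The quadratic part `q₁(y) = v y₀ y₄` as a bilinear map applied to two projections. [folklore] -/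
theorem contDiff_quad (v : ℝ) : ContDiff ℝ ∞ (fun y : R5 => v * y 0 * y 4) := by
  fun_prop

/-- `Φ_v` is smooth. [folklore] -/
theorem contDiff_PhiV (v : ℝ) : ContDiff ℝ ∞ (PhiV v) := by
  unfold PhiV
  fun_prop

/-- Iterated derivatives of a coordinate projection (as a function). [folklore] -/
theorem norm_iteratedFDeriv_coord_le (l : Fin 5) (i : ℕ) (y : R5) :
    ‖iteratedFDeriv ℝ i (fun y : R5 => y l) y‖ ≤ (if i = 0 then |y l| else 0) + (if i = 1 then 1 else 0) := by
  have h := norm_iteratedFDeriv_clm_le (ContinuousLinearMap.proj l : R5 →L[ℝ] ℝ) i y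
  have hfun : (⇑(ContinuousLinearMap.proj l : R5 →L[ℝ] ℝ)) = fun y : R5 => y l := rfl
  rw [hfun] at h
  refine h.trans (add_le_add ?_ ?_)
  · split_ifs
    · simp
    · exact le_rfl
  · split_ifs
    · exact norm_proj_le_one l
    · exact le_rfl

/-- **`‖Dⁱ(y ↦ v y₀ y₄)(y)‖ ≤ |v| (|y₀| + |y₄| + 2)`** for `i ≥ 1`. [folklore] -/
theorem norm_iteratedFDeriv_quad_le (v : ℝ) {i : ℕ} (hi : 1 ≤ i) (y : R5) :
    ‖iteratedFDeriv ℝ i (fun y : R5 => v * y 0 * y 4) y‖ ≤ |v| * (|y 0| + |y 4| + 2) := by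
  -- `v y₀ y₄ = F(y) G(y)` with the linear `F = v • proj₀`, `G = proj₄`
  set F : R5 →L[ℝ] ℝ := v • (ContinuousLinearMap.proj 0 : R5 →L[ℝ] ℝ) with hF
  set G : R5 →L[ℝ] ℝ := (ContinuousLinearMap.proj 4 : R5 →L[ℝ] ℝ) with hG
  have hFG : (fun y : R5 => v * y 0 * y 4) = fun y : R5 => F y * G y := by
    funext y; simp [hF, hG]
  have hFnorm : ‖F‖ ≤ |v| := by
    rw [hF, norm_smul, Real.norm_eq_abs]
    exact mul_le_of_le_one_right (abs_nonneg v) (norm_proj_le_one 0)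
  have hGnorm : ‖G‖ ≤ 1 := norm_proj_le_one 4
  have hF0 : ‖iteratedFDeriv ℝ 0 (⇑F) y‖ ≤ |v| * |y 0| := by
    rw [norm_iteratedFDeriv_zero]; simp [hF]
  have hF1 : ‖iteratedFDeriv ℝ 1 (⇑F) y‖ ≤ |v| := by rw [norm_iteratedFDeriv_clm_one]; exact hFnorm
  have hF2 : ∀ m, ‖iteratedFDeriv ℝ (m + 2) (⇑F) y‖ = 0 := fun m => norm_iteratedFDeriv_clm_add_two F m y
  have hG0 : ‖iteratedFDeriv ℝ 0 (⇑G) y‖ ≤ |y 4| := by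
    rw [norm_iteratedFDeriv_zero]; simp [hG]
  have hG1 : ‖iteratedFDeriv ℝ 1 (⇑G) y‖ ≤ 1 := by rw [norm_iteratedFDeriv_clm_one]; exact hGnorm
  have hG2 : ∀ m, ‖iteratedFDeriv ℝ (m + 2) (⇑G) y‖ = 0 := fun m => norm_iteratedFDeriv_clm_add_two G m y
  rw [hFG]
  refine (norm_iteratedFDeriv_mul_le F.contDiff G.contDiff y (n := i) (by exact_mod_cast le_top)).trans ?_
  rcases Nat.lt_or_ge i 3 with hi3 | hi3
  · obtain rfl | rfl : i = 1 ∨ i = 2 := by omega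
    · -- `i = 1`
      rw [Finset.sum_range_succ, Finset.sum_range_succ, Finset.sum_range_zero, zero_add]
      simp only [Nat.choose_zero_right, Nat.cast_one, one_mul, Nat.sub_zero, Nat.choose_self]
      have n0 := norm_nonneg (iteratedFDeriv ℝ 0 (⇑F) y)
      have n1 := norm_nonneg (iteratedFDeriv ℝ 1 (⇑F) y)
      nlinarith [mul_le_mul hF0 hG1 (norm_nonneg _) (by positivity),
        mul_le_mul hF1 hG0 (norm_nonneg _) (abs_nonneg v), abs_nonneg (y 0), abs_nonneg (y 4),
        abs_nonneg v]
    · -- `i = 2`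
      rw [Finset.sum_range_succ, Finset.sum_range_succ, Finset.sum_range_succ,
        Finset.sum_range_zero, zero_add]
      simp only [Nat.choose_zero_right, Nat.cast_one, one_mul, Nat.sub_zero, hG2 0, mul_zero,
        hF2 0, zero_mul, add_zero, zero_add, show Nat.choose 2 1 = 2 from rfl]
      have n1 := norm_nonneg (iteratedFDeriv ℝ 1 (⇑F) y)
      push_cast
      nlinarith [mul_le_mul hF1 hG1 (norm_nonneg _) (abs_nonneg v), abs_nonneg (y 0),
        abs_nonneg (y 4), abs_nonneg v]
  · -- `i ≥ 3`: every term vanishes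
    have hzero : ∀ l ∈ Finset.range (i + 1), (i.choose l : ℝ) *
        ‖iteratedFDeriv ℝ l (⇑F) y‖ * ‖iteratedFDeriv ℝ (i - l) (⇑G) y‖ = 0 := by
      intro l _
      rcases Nat.lt_or_ge l 2 with hl | hl
      · obtain ⟨m, hm⟩ : ∃ m, i - l = m + 2 := ⟨i - l - 2, by omega⟩
        rw [hm, hG2 m, mul_zero]
      · obtain ⟨m, hm⟩ : ∃ m, l = m + 2 := ⟨l - 2, by omega⟩
        rw [hm, hF2 m, mul_zero, zero_mul]
    rw [Finset.sum_eq_zero hzero]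
    positivity

/-- **`‖Dⁱ Φ_v(y)‖ ≤ (2 + |v|(|y₀| + |y₄| + 2))ⁱ`** for `i ≥ 1`. [folklore] -/
theorem norm_iteratedFDeriv_PhiV_le (v : ℝ) (y : R5) {i : ℕ} (hi : 1 ≤ i) :
    ‖iteratedFDeriv ℝ i (PhiV v) y‖ ≤ (2 + |v| * (|y 0| + |y 4| + 2)) ^ i := by
  -- split `Φ_v = id + (q • e₁)` with `q = v y₀ y₄ − y₁`
  have hid : ContDiff ℝ ∞ (fun y : R5 => y) := contDiff_id
  have hq : ContDiff ℝ ∞ (fun y : R5 => v * y 0 * y 4 - y 1) := by fun_prop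
  have hqe : ContDiff ℝ ∞ (fun y : R5 => (v * y 0 * y 4 - y 1) • e5 1) := hq.smul contDiff_const
  have hsplit : PhiV v = fun y => (fun y : R5 => y) y + (fun y : R5 => (v * y 0 * y 4 - y 1) • e5 1) y := by
    funext y; rfl
  have h1 : ‖iteratedFDeriv ℝ i (fun y : R5 => y) y‖ ≤ 1 := by
    have := norm_iteratedFDeriv_clm_le (ContinuousLinearMap.id ℝ R5) i y
    rw [ContinuousLinearMap.coe_id'] at this
    refine this.trans ?_
    have hid1 : ‖ContinuousLinearMap.id ℝ R5‖ ≤ 1 := ContinuousLinearMap.norm_id_le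
    split_ifs <;> simp_all
  -- the smul part through the rank-one map `t ↦ t • e₁`
  set L : ℝ →L[ℝ] R5 := ContinuousLinearMap.smulRight (1 : ℝ →L[ℝ] ℝ) (e5 1) with hL
  have hLnorm : ‖L‖ ≤ 1 := by
    rw [hL, ContinuousLinearMap.norm_smulRight_apply, norm_e5, mul_one]
    exact ContinuousLinearMap.norm_id_le
  have hcomp : (fun y : R5 => (v * y 0 * y 4 - y 1) • e5 1) = L ∘ (fun y : R5 => v * y 0 * y 4 - y 1) := by
    funext y; simp [hL]
  have h2 : ‖iteratedFDeriv ℝ i (fun y : R5 => (v * y 0 * y 4 - y 1) • e5 1) y‖ ≤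
      |v| * (|y 0| + |y 4| + 2) + 1 := by
    rw [hcomp]
    refine (L.norm_iteratedFDeriv_comp_left (hq.contDiffAt) (n := i) (by exact_mod_cast le_top)).trans ?_
    have hq' : ‖iteratedFDeriv ℝ i (fun y : R5 => v * y 0 * y 4 - y 1) y‖ ≤
        |v| * (|y 0| + |y 4| + 2) + 1 := by
      have hsub : (fun y : R5 => v * y 0 * y 4 - y 1) =
          fun y => (fun y : R5 => v * y 0 * y 4) y - (fun y : R5 => y 1) y := rfl
      have hqa : ContDiff ℝ i (fun y : R5 => v * y 0 * y 4) :=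
        (contDiff_quad v).of_le (by exact_mod_cast le_top)
      have hpa : ContDiff ℝ i (fun y : R5 => y 1) :=
        (contDiff_apply ℝ ℝ 1).of_le (by exact_mod_cast le_top)
      rw [hsub, fun_iteratedFDeriv_sub_apply hqa.contDiffAt hpa.contDiffAt]
      refine (norm_sub_le _ _).trans (add_le_add (norm_iteratedFDeriv_quad_le v hi y) ?_)
      refine (norm_iteratedFDeriv_coord_le 1 i y).trans ?_
      have hi0 : i ≠ 0 := by omega
      simp only [hi0, if_false, zero_add]
      split_ifs <;> norm_num
    calc ‖L‖ * ‖iteratedFDeriv ℝ i (fun y : R5 => v * y 0 * y 4 - y 1) y‖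
        ≤ 1 * (|v| * (|y 0| + |y 4| + 2) + 1) :=
          mul_le_mul hLnorm hq' (norm_nonneg _) zero_le_one
      _ = _ := one_mul _
  have hida : ContDiff ℝ i (fun y : R5 => y) := hid.of_le (by exact_mod_cast le_top)
  have hqea : ContDiff ℝ i (fun y : R5 => (v * y 0 * y 4 - y 1) • e5 1) :=
    hqe.of_le (by exact_mod_cast le_top)
  rw [hsplit, fun_iteratedFDeriv_add_apply hida.contDiffAt hqea.contDiffAt]
  refine (norm_add_le _ _).trans ?_
  have hbase : (1 : ℝ) + (|v| * (|y 0| + |y 4| + 2) + 1) = 2 + |v| * (|y 0| + |y 4| + 2) := by ring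
  have hge1 : (1 : ℝ) ≤ 2 + |v| * (|y 0| + |y 4| + 2) := by
    have : 0 ≤ |v| * (|y 0| + |y 4| + 2) := by positivity
    linarith
  calc ‖iteratedFDeriv ℝ i (fun y : R5 => y) y‖ +
        ‖iteratedFDeriv ℝ i (fun y : R5 => (v * y 0 * y 4 - y 1) • e5 1) y‖
      ≤ 1 + (|v| * (|y 0| + |y 4| + 2) + 1) := add_le_add h1 h2
    _ = (2 + |v| * (|y 0| + |y 4| + 2)) ^ 1 := by rw [hbase, pow_one]
    _ ≤ (2 + |v| * (|y 0| + |y 4| + 2)) ^ i := pow_le_pow_right₀ hge1 hi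

/-- **Faà di Bruno through `Φ_v`**: if `‖Dⁱ G(Φ_v y)‖ ≤ C_g` for `i ≤ n` then
`‖Dⁿ (G ∘ Φ_v)(y)‖ ≤ n! · C_g · (2 + |v|(|y₀| + |y₄| + 2))ⁿ`. [folklore] -/
theorem norm_iteratedFDeriv_comp_PhiV_le {G : R5 → ℂ} (hG : ContDiff ℝ ∞ G) (v : ℝ) (y : R5)
    {n : ℕ} {Cg : ℝ} (hC : ∀ i, i ≤ n → ‖iteratedFDeriv ℝ i G (PhiV v y)‖ ≤ Cg) :
    ‖iteratedFDeriv ℝ n (fun y => G (PhiV v y)) y‖ ≤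
      n.factorial * Cg * (2 + |v| * (|y 0| + |y 4| + 2)) ^ n :=
  norm_iteratedFDeriv_comp_le (g := G) (f := PhiV v) hG (contDiff_PhiV v) (by exact_mod_cast le_top)
    y hC (fun i hi _ => norm_iteratedFDeriv_PhiV_le v y hi)

end KloostermanQuintilinear

end Literature.NumberTheory.Sieve

end
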